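import Mathlib
import Literature.AlgebraicGeometry.Resolution.FiniteOverCompleteLocal
import Literature.RingTheory.KrullDimension.AffineDimension

/-!
# Finite extensions of a complete local domain inside a fraction field are complete local —
# sub-goal (H0) of stub (R) `stub_raynaudConnectedness`

Route `SkinnerWilesDefectOne`, crux `ReducibleOrdinaryProModular` (stmt-Langlands-12919), line
`fine-selmer-codimension-two`, registered stub (R) `stub_raynaudConnectedness` (Grothendieck's
connectedness theorem SGA2 XIII 2.1 in crossing form).  In the HLVT-free proof of (R) the complete
local domain `D` (finite over a complete Noetherian local domain `S ⊆ D`) is replaced by its reflexive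
hull `D' ⊆ Frac D`, a `D`-subalgebra admitting an `S`-linear embedding `D' ↪ Sᵃ`
(`…ReflexiveHull.lean`).  This file records the ring-theoretic properties of ANY such subalgebra:
it is a finite `S`-module, a Noetherian domain, integral over `D`, of the same Krull dimension as `D`
and `S`, and a complete local ring whose maximal ideal is, up to radical, the extension of `𝔪_S`.
Sorry-free; Mathlib plus two tree files:

* `Theorems.isHausdorff_of_pow_le`, `Theorems.isPrecomplete_of_pow_le`,
  `Theorems.isAdicComplete_of_pow_le` — **change of ideal for adic completeness** in the direction
  "`J`-adically complete, `J ≤ I`, `I ^ e ≤ J` ⇒ `I`-adically complete" (the two adic topologies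
  coincide; the tree has the converse direction in `FontaineThetaNaturality`);
* `Theorems.map_maximalIdeal_le_of_isIntegral`, `Theorems.maximalIdeal_le_radical_map_of_isIntegral`
  — for an integral extension `A → B` of local rings, `𝔪_A B ≤ 𝔪_B ≤ √(𝔪_A B)` (lying over /
  maximality of primes over a maximal ideal, Mathlib `Ideal.isMaximal_comap_of_isIntegral_of_isMaximal`,
  `Ideal.isMaximal_of_isIntegral_of_isMaximal_comap`);
* `Theorems.isAdicComplete_maximalIdeal_of_finite` — **a local ring module-finite over a complete
  Noetherian local ring is complete** (Matsumura 8.7 via the tree's `isAdicComplete_map_of_finite`,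
  then change of ideal from `𝔪_A B` to `𝔪_B`);
* `Theorems.subalgebra_fractionRing_completeLocal_of_injective` — the bundle of properties of a
  `D`-subalgebra `D' ⊆ Frac D` with an injective `S`-linear map `D' → Sᵃ`, at universe `u`;
* `FineSelmerCodimensionTwo.stub_raynaudConnectedness_auxHullCompleteLocal` — the REGISTERED
  sub-goal (H0), binders verbatim, at universe `0`.

References: H. Matsumura, *Commutative Ring Theory*, Thms. 8.7, 8.15, 9.3, 9.4 [Matsumura1987];
A. Grothendieck, SGA 2, Exp. XIII Thm. 2.1 [Grothendieck1968SGA2]; N. Bourbaki, *Algèbre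
commutative* III §2.12 (comparison of adic topologies), VII §4.2 [BourbakiAC].
-/

set_option linter.dupNamespace false -- project-wide option (lakefile weak.linter.dupNamespace); `Summit.Langlands.Langlands` is the mandated namespace
set_option autoImplicit false

namespace Summit.Langlands.Langlands.Theorems

open IsLocalRing

/-! ## 1. Change of ideal for adic completeness -/

section AdicComplete

variable {R : Type*} [CommRing R] {M : Type*} [AddCommGroup M] [Module R M] {I J : Ideal R}

/-- If `I ^ e ≤ J`, a `J`-adically separated module is `I`-adically separated
(`⋂ Iⁿ M ⊆ ⋂ I^{e n} M ⊆ ⋂ Jⁿ M = 0`). [folklore] -/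
theorem isHausdorff_of_pow_le {e : ℕ} (hIJ : I ^ e ≤ J) [IsHausdorff J M] : IsHausdorff I M := by
  refine ⟨fun x hx => IsHausdorff.haus' (I := J) x fun n => ?_⟩
  refine (hx (e * n)).mono (Submodule.smul_mono_left ?_)
  rw [pow_mul]
  exact Ideal.pow_right_mono hIJ n

/-- If `J ≤ I` and `I ^ e ≤ J`, a `J`-adically precomplete module is `I`-adically precomplete: for an
`I`-Cauchy sequence `f`, `n ↦ f (e n)` is `J`-Cauchy, and its `J`-adic limit is an `I`-adic limit of
`f` because `Jⁿ ≤ Iⁿ`. [folklore] -/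
theorem isPrecomplete_of_pow_le (hJI : J ≤ I) {e : ℕ} (hIJ : I ^ e ≤ J) [IsPrecomplete J M] :
    IsPrecomplete I M := by
  rcases Nat.eq_zero_or_pos e with rfl | he
  · -- `I ^ 0 = ⊤ ≤ J ≤ I`: the `I`-adic topology is indiscrete
    have hJ : J = ⊤ := top_le_iff.mp (by simpa using hIJ)
    have hI : I = ⊤ := top_le_iff.mp (hJ ▸ hJI)
    subst hI
    refine ⟨fun {f} _ => ⟨0, fun n => ?_⟩⟩
    rw [Ideal.top_pow, Submodule.top_smul]
    exact SModEq.top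
  refine ⟨fun {f} hf => ?_⟩
  -- `n ↦ f (e * n)` is `J`-Cauchy
  have hg : ∀ {m n : ℕ}, m ≤ n →
      f (e * m) ≡ f (e * n) [SMOD (J ^ m • ⊤ : Submodule R M)] := fun {m n} hmn => by
    refine (hf (Nat.mul_le_mul_left e hmn)).mono (Submodule.smul_mono_left ?_)
    rw [pow_mul]
    exact Ideal.pow_right_mono hIJ m
  obtain ⟨L, hL⟩ := IsPrecomplete.prec' (I := J) (fun n => f (e * n)) hg
  refine ⟨L, fun n => ?_⟩
  have h1 : f n ≡ f (e * n) [SMOD (I ^ n • ⊤ : Submodule R M)] := hf (Nat.le_mul_of_pos_left n he)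
  have h2 : f (e * n) ≡ L [SMOD (I ^ n • ⊤ : Submodule R M)] :=
    (hL n).mono (Submodule.smul_mono_left (Ideal.pow_right_mono hJI n))
  exact h1.trans h2

/-- **Change of ideal for adic completeness**: if `J ≤ I` and `I ^ e ≤ J` (so the `I`-adic and
`J`-adic topologies agree), a `J`-adically complete module is `I`-adically complete. [folklore] -/
theorem isAdicComplete_of_pow_le (hJI : J ≤ I) {e : ℕ} (hIJ : I ^ e ≤ J) [IsAdicComplete J M] :
    IsAdicComplete I M :=
  haveI := isHausdorff_of_pow_le (M := M) hIJ
  haveI := isPrecomplete_of_pow_le (M := M) hJI hIJ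
  ⟨⟩

end AdicComplete

/-! ## 2. Integral extensions of local rings: `𝔪_A B ≤ 𝔪_B ≤ √(𝔪_A B)` -/

section Integral

variable {A B : Type*} [CommRing A] [CommRing B] [IsLocalRing A] [IsLocalRing B] [Algebra A B]
  [Algebra.IsIntegral A B]

/-- For an integral extension `A → B` of local rings, `𝔪_B` contracts to `𝔪_A` (the contraction of a
maximal ideal along an integral map is maximal). [folklore] -/
theorem comap_maximalIdeal_of_isIntegral : (maximalIdeal B).comap (algebraMap A B) = maximalIdeal A :=
  eq_maximalIdeal (Ideal.isMaximal_comap_of_isIntegral_of_isMaximal (R := A) (maximalIdeal B))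

/-- For an integral extension `A → B` of local rings, `𝔪_A B ≤ 𝔪_B`. [folklore] -/
theorem map_maximalIdeal_le_of_isIntegral :
    (maximalIdeal A).map (algebraMap A B) ≤ maximalIdeal B :=
  Ideal.map_le_iff_le_comap.mpr (comap_maximalIdeal_of_isIntegral (A := A) (B := B)).ge

/-- For an integral extension `A → B` of local rings, `𝔪_B ≤ √(𝔪_A B)`: every prime of `B`
containing `𝔪_A B` lies over the maximal ideal `𝔪_A`, hence is maximal, hence is `𝔪_B`. [folklore] -/
theorem maximalIdeal_le_radical_map_of_isIntegral :
    maximalIdeal B ≤ ((maximalIdeal A).map (algebraMap A B)).radical := by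
  rw [Ideal.radical_eq_sInf]
  refine le_sInf ?_
  rintro P ⟨hJP, hP⟩
  have h1 : maximalIdeal A ≤ P.comap (algebraMap A B) := Ideal.map_le_iff_le_comap.mp hJP
  have h2 : maximalIdeal A = P.comap (algebraMap A B) :=
    (maximalIdeal.isMaximal A).eq_of_le (Ideal.IsPrime.ne_top inferInstance) h1
  have h3 : (P.comap (algebraMap A B)).IsMaximal := h2 ▸ maximalIdeal.isMaximal A
  have hPmax : P.IsMaximal := Ideal.isMaximal_of_isIntegral_of_isMaximal_comap P h3
  exact (eq_maximalIdeal hPmax).ge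

end Integral

/-! ## 3. Finite local algebras over complete local rings are complete -/

universe u

/-- **A local ring `B` which is module-finite over a complete Noetherian local ring `A` is
`𝔪_B`-adically complete**: `B` is `𝔪_A B`-adically complete (Matsumura 8.7, tree
`isAdicComplete_map_of_finite`), `𝔪_A B ≤ 𝔪_B ≤ √(𝔪_A B)` (integrality), and `𝔪_B` is finitely
generated (`B` is Noetherian), so `𝔪_B ^ e ≤ 𝔪_A B` for some `e` and the two adic topologies
coincide. [cite: Matsumura1987, Thm. 8.7] -/
theorem isAdicComplete_maximalIdeal_of_finite (A B : Type u) [CommRing A] [IsLocalRing A]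
    [IsNoetherianRing A] [IsAdicComplete (maximalIdeal A) A] [CommRing B] [IsLocalRing B]
    [Algebra A B] [Module.Finite A B] : IsAdicComplete (maximalIdeal B) B := by
  haveI : IsNoetherianRing B :=
    isNoetherian_of_tower A (isNoetherian_of_isNoetherianRing_of_finite A B)
  haveI : Algebra.IsIntegral A B := Algebra.IsIntegral.of_finite A B
  haveI : IsAdicComplete ((maximalIdeal A).map (algebraMap A B)) B :=
    Literature.AlgebraicGeometry.Resolution.isAdicComplete_map_of_finite A B (maximalIdeal A)
  obtain ⟨e, he⟩ := Ideal.exists_pow_le_of_le_radical_of_fg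
    (maximalIdeal_le_radical_map_of_isIntegral (A := A) (B := B)) (IsNoetherian.noetherian _)
  exact isAdicComplete_of_pow_le (map_maximalIdeal_le_of_isIntegral (A := A) (B := B)) he

/-! ## 4. Subalgebras of `Frac D` embedding in a finite free `S`-module -/

/-- **A `D`-subalgebra `D' ⊆ Frac D` with an injective `S`-linear map `D' → Sᵃ` is a complete local
Noetherian domain, finite over `S`, integral over `D`, of Krull dimension `dim D = dim S`, with
`𝔪_S D' ≤ 𝔪_{D'} ≤ √(𝔪_S D')`** — for `D` a domain module-finite and torsion-free over a complete
Noetherian local domain `S`.  (`D'` is a submodule of the Noetherian module `Sᵃ`, hence finite over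
`S`, hence over `D`; dimensions agree along injective integral maps, tree
`ringKrullDim_eq_of_isIntegral`; a domain finite over a complete local ring is local, tree
`isLocalRing_of_isDomain_of_finite_of_isAdicComplete`, and complete,
`isAdicComplete_maximalIdeal_of_finite`.) [folklore] -/
theorem subalgebra_fractionRing_completeLocal_of_injective (S : Type u) [CommRing S] [IsDomain S]
    [IsNoetherianRing S] [IsLocalRing S] [IsAdicComplete (maximalIdeal S) S] (D : Type u)
    [CommRing D] [IsDomain D] [Algebra S D] [Module.Finite S D]
    (hinj : Function.Injective (algebraMap S D)) (D' : Subalgebra D (FractionRing D)) (a : ℕ)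
    (Φ : D' →ₗ[S] (Fin a → S)) (hΦ : Function.Injective Φ) :
    Module.Finite S D' ∧ IsNoetherianRing D' ∧ Algebra.IsIntegral D D' ∧
      Function.Injective (algebraMap D D') ∧ Function.Injective (algebraMap S D') ∧
      ringKrullDim D' = ringKrullDim D ∧ ringKrullDim D = ringKrullDim S ∧
      ∃ _ : IsLocalRing D', IsAdicComplete (maximalIdeal D') D' ∧
        (maximalIdeal S).map (algebraMap S D') ≤ maximalIdeal D' ∧
        maximalIdeal D' ≤ ((maximalIdeal S).map (algebraMap S D')).radical := by
  -- (i) finiteness over `S`, (ii) Noetherianity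
  haveI hfin : Module.Finite S D' := Module.Finite.of_injective Φ hΦ
  haveI hnoeth : IsNoetherianRing D' :=
    isNoetherian_of_tower S (isNoetherian_of_isNoetherianRing_of_finite S D')
  -- (iii) integrality over `D`
  haveI : Module.Finite D D' := Module.Finite.of_restrictScalars_finite S D D'
  haveI hint : Algebra.IsIntegral D D' := Algebra.IsIntegral.of_finite D D'
  haveI : Algebra.IsIntegral S D := Algebra.IsIntegral.of_finite S D
  haveI : Algebra.IsIntegral S D' := Algebra.IsIntegral.of_finite S D'
  -- (iv), (v) injectivity of the structure maps
  have hD : Function.Injective (algebraMap D D') := fun x y hxy =>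
    IsFractionRing.injective D (FractionRing D) (congrArg Subtype.val hxy :)
  have hS : Function.Injective (algebraMap S D') := by
    rw [IsScalarTower.algebraMap_eq S D D', RingHom.coe_comp]
    exact hD.comp hinj
  -- (vi), (vii) Krull dimensions
  have hdimSD : ringKrullDim S = ringKrullDim D :=
    Literature.RingTheory.KrullDimension.ringKrullDim_eq_of_isIntegral hinj
  have hdimDD' : ringKrullDim D = ringKrullDim D' :=
    Literature.RingTheory.KrullDimension.ringKrullDim_eq_of_isIntegral hD
  -- (viii) locality, (ix) completeness, (x)–(xi) comparison of `𝔪_S D'` and `𝔪_{D'}`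
  haveI hloc : IsLocalRing D' :=
    Literature.AlgebraicGeometry.Resolution.isLocalRing_of_isDomain_of_finite_of_isAdicComplete S D'
  exact ⟨hfin, hnoeth, hint, hD, hS, hdimDD'.symm, hdimSD.symm, hloc,
    isAdicComplete_maximalIdeal_of_finite S D', map_maximalIdeal_le_of_isIntegral,
    maximalIdeal_le_radical_map_of_isIntegral⟩

end Summit.Langlands.Langlands.Theorems

/-! ## 5. The registered sub-goal (verbatim signature) -/

namespace Summit.Langlands.Langlands.Cruxes.ReducibleOrdinaryProModular.FineSelmerCodimensionTwo

set_option linter.overlappingInstances false in -- registered signature: `[IsDomain S]` and `[IsLocalRing S]` verbatim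
/-- **Registered sub-goal `stub_raynaudConnectedness_auxHullCompleteLocal` of stub (R)
`stub_raynaudConnectedness`** (part (H0) of the SGA2 XIII 2.1 programme): a `D`-subalgebra
`D' ⊆ Frac D` admitting an injective `S`-linear map into some `Sᵃ` — e.g. the reflexive hull of the
domain `D` finite and torsion-free over the complete Noetherian local domain `S` — is finite over `S`,
Noetherian, integral over `D` with `D ↪ D'` and `S ↪ D'`, of Krull dimension `dim D = dim S`, and a
complete local ring with `𝔪_S D' ≤ 𝔪_{D'} ≤ √(𝔪_S D')` —
`Theorems.subalgebra_fractionRing_completeLocal_of_injective` at universe `0`. [folklore] -/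
theorem stub_raynaudConnectedness_auxHullCompleteLocal :
    ∀ (S : Type) [CommRing S] [IsDomain S] [IsNoetherianRing S] [IsLocalRing S]
      [IsAdicComplete (IsLocalRing.maximalIdeal S) S] (D : Type) [CommRing D] [IsDomain D] [Algebra S D]
      [Module.Finite S D], Function.Injective (algebraMap S D) →
      ∀ (D' : Subalgebra D (FractionRing D)) (a : ℕ) (Φ : D' →ₗ[S] (Fin a → S)), Function.Injective Φ →
        Module.Finite S D' ∧ IsNoetherianRing D' ∧ Algebra.IsIntegral D D' ∧
        Function.Injective (algebraMap D D') ∧ Function.Injective (algebraMap S D') ∧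
        ringKrullDim D' = ringKrullDim D ∧ ringKrullDim D = ringKrullDim S ∧
        ∃ _ : IsLocalRing D', IsAdicComplete (IsLocalRing.maximalIdeal D') D' ∧
          (IsLocalRing.maximalIdeal S).map (algebraMap S D') ≤ IsLocalRing.maximalIdeal D' ∧
          IsLocalRing.maximalIdeal D' ≤ ((IsLocalRing.maximalIdeal S).map (algebraMap S D')).radical :=
  fun S _ _ _ _ _ D _ _ _ _ hinj D' a Φ hΦ =>
    Summit.Langlands.Langlands.Theorems.subalgebra_fractionRing_completeLocal_of_injective
      S D hinj D' a Φ hΦ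

end Summit.Langlands.Langlands.Cruxes.ReducibleOrdinaryProModular.FineSelmerCodimensionTwo
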